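import Summits.Ventures.LatticeQCDFlow.Scaling.StepChainResolvent

/-!
HONEST FRAMING: exact (Metropolis-corrected) sampling algorithms for lattice gauge theory; figures
of merit are autocorrelation/cost numbers at stated couplings and volumes; no continuum-physics
claim.

# CycleStepFormBound — FROM THE GEOMETRIC DECAY OF THE CYCLE CHAIN `C = UB` TO THE QUADRATIC-FORM BOUND `‖BUg‖²_π ≤ θ·⟨g,Ug⟩_π` ON MEAN-ZERO `g`
# (THE MOMENT ARGUMENT OF THE CYCLE → STEP TRANSFER, OPEN-MATH ITEM 1 (i) (b) ROUTE (α); lean-2 GEN-38, ours)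

Venture-side (OURS).  Cell `lqcd-flow` (pub-lqcd), unit `pub-lqcd-lean-2-g38`, 2026-08-30.  Chapter X (item 1 (i) (b)), file 2.  Setting of file X1 (`StepChainResolvent`): `A ≥ 0` with unit row
sums, reversible w.r.t. `π > 0`, `σ ∈ [0,1)`, `U` its resolvent kernel; in addition a kernel `B` reversible w.r.t. `π` and IDEMPOTENT (`B² = B`, the redraw), the cycle kernel `C = UB`, its
powers `C^n` (hypothesis-equations `C⁰ = I`, `C^{n+1} = C^nC`), the law `π_C = πB`, and the GEOMETRIC DECAY `Σ_y|C^n(x,y) − π_C(y)| ≤ 2C₀θⁿ` (what chapter W's law W27 delivers for the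
refresh-cycle chain, `θ = 1−ρ`).  With `v_k = (BU)^kg` and the moments `M(n) = ⟨g, U v_n⟩_π = ⟨g, C^n(Ug)⟩_π`: the shift identity `⟨v_i,Uv_{k+1}⟩ = ⟨v_{i+1},Uv_k⟩` (self-adjointness of
`U`, `B`), `M(1) = ‖BUg‖²_π ≥ 0`, Cauchy–Schwarz (X1) `M(a)² ≤ M(0)M(2a)`, hence `M(1)^{2^k} ≤ M(0)^{2^k−1}M(2^k)`; for mean-zero `g` the decay gives `M(n) ≤ Dθⁿ`, and letting `k → ∞`:
**`‖BUg‖²_π ≤ θ⟨g,Ug⟩_π`** (`cycleStep_form_bound`) — the form version of «every non-trivial eigenvalue of `U^{1/2}BU^{1/2}` is `≤ θ`», obtained without square roots or the spectral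
theorem.  File X3 turns it into the Dirichlet-form (spectral gap) bound `gap(σA + (1−σ)B) ≥ (1−σ)(1−θ)` for the step chain.  Hypothesis-equations, no definitions.

## What is proved

* `idem_form_eq_normSq` (`⟨w,Bw⟩_π = ‖Bw‖²_π`), `cycle_pow_apply` (`C^n(Uv_k) = Uv_{n+k}`), `cycle_moment_shift`, `cycle_moment_sq_le`, `cycle_moment_pow_le`, `cycle_moment_decay`,
  **`cycleStep_form_bound`**.

Reading (no numerics implied): standard.  Literature grade (cell rule): OWN, elementary; nothing cited as a fact; no new bib keys.
-/

open Finset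

namespace Summit.Ventures.LatticeQCDFlow.Scaling

section CycleStep
variable {X : Type*} [Fintype X] [DecidableEq X]
variable {π : X → ℝ} {A U B C : X → X → ℝ} {σ : ℝ}

omit [DecidableEq X] in
/-- For an idempotent kernel reversible w.r.t. `π`: `⟨w,Bw⟩_π = ‖Bw‖²_π`. [ours] -/
theorem idem_form_eq_normSq (hBrev : ∀ x y, π x * B x y = π y * B y x) (hBB : ∀ x y, ∑ z, B x z * B z y = B x y) (w : X → ℝ) :
    ∑ x, π x * w x * ∑ y, B x y * w y = ∑ x, π x * (∑ y, B x y * w y) ^ 2 := by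
  -- `⟨w,Bw⟩ = ⟨w,B(Bw)⟩ = ⟨Bw,Bw⟩`
  have e1 : ∀ x, ∑ y, B x y * w y = ∑ z, B x z * ∑ y, B z y * w y := by
    intro x
    calc ∑ y, B x y * w y = ∑ y, (∑ z, B x z * B z y) * w y := sum_congr rfl fun y _ => by rw [hBB x y]
      _ = ∑ y, ∑ z, B x z * B z y * w y := sum_congr rfl fun y _ => by rw [sum_mul]
      _ = ∑ z, B x z * ∑ y, B z y * w y := by rw [sum_comm]; exact sum_congr rfl fun z _ => by rw [mul_sum]; exact sum_congr rfl fun y _ => by ring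
  calc ∑ x, π x * w x * ∑ y, B x y * w y = ∑ x, π x * w x * ∑ z, B x z * ∑ y, B z y * w y := sum_congr rfl fun x _ => by rw [← e1 x]
    _ = ∑ x, ∑ z, π x * B x z * (w x * ∑ y, B z y * w y) := sum_congr rfl fun x _ => by rw [mul_sum]; exact sum_congr rfl fun z _ => by ring
    _ = ∑ x, ∑ z, π z * B z x * (w x * ∑ y, B z y * w y) := sum_congr rfl fun x _ => sum_congr rfl fun z _ => by rw [hBrev x z]
    _ = ∑ z, ∑ x, π z * B z x * (w x * ∑ y, B z y * w y) := sum_comm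
    _ = ∑ z, π z * (∑ y, B z y * w y) ^ 2 := by
        refine sum_congr rfl fun z _ => ?_
        rw [sq, ← mul_assoc, mul_sum univ _ (π z), sum_mul]
        exact sum_congr rfl fun x _ => by ring

variable {v : ℕ → X → ℝ} {Cp : ℕ → X → X → ℝ}

omit [DecidableEq X] in
/-- `C^n(Uv_k) = Uv_{n+k}` for `C = UB`, `v_{k+1} = BUv_k`. [ours] -/
theorem cycle_pow_apply [DecidableEq X] (hC : ∀ x y, C x y = ∑ z, U x z * B z y) (hCp0 : ∀ x y, Cp 0 x y = if x = y then 1 else 0)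
    (hCpS : ∀ n x y, Cp (n + 1) x y = ∑ z, Cp n x z * C z y) (hvS : ∀ k x, v (k + 1) x = ∑ y, B x y * ∑ w, U y w * v k w) :
    ∀ n k x, ∑ y, Cp n x y * ∑ w, U y w * v k w = ∑ w, U x w * v (n + k) w := by
  intro n
  induction n with
  | zero => intro k x; simp only [hCp0, ite_mul, one_mul, zero_mul, sum_ite_eq, mem_univ, if_true, Nat.zero_add]
  | succ n ih =>
    intro k x
    -- `C^{n+1}(Uv_k) = C^n(C(Uv_k)) = C^n(U v_{k+1}) = U v_{n+k+1}`
    have hCU : ∀ z, ∑ y, C z y * ∑ w, U y w * v k w = ∑ w, U z w * v (k + 1) w := by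
      intro z
      calc ∑ y, C z y * ∑ w, U y w * v k w = ∑ y, (∑ t, U z t * B t y) * ∑ w, U y w * v k w := sum_congr rfl fun y _ => by rw [hC z y]
        _ = ∑ y, ∑ t, U z t * B t y * ∑ w, U y w * v k w := sum_congr rfl fun y _ => by rw [sum_mul]
        _ = ∑ t, U z t * ∑ y, B t y * ∑ w, U y w * v k w := by rw [sum_comm]; exact sum_congr rfl fun t _ => by rw [mul_sum]; exact sum_congr rfl fun y _ => by ring
        _ = ∑ t, U z t * v (k + 1) t := sum_congr rfl fun t _ => by rw [hvS k t]
    calc ∑ y, Cp (n + 1) x y * ∑ w, U y w * v k w = ∑ y, (∑ z, Cp n x z * C z y) * ∑ w, U y w * v k w := sum_congr rfl fun y _ => by rw [hCpS n x y]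
      _ = ∑ z, Cp n x z * ∑ y, C z y * ∑ w, U y w * v k w := by
          rw [show (∑ y, (∑ z, Cp n x z * C z y) * ∑ w, U y w * v k w) = ∑ y, ∑ z, Cp n x z * C z y * ∑ w, U y w * v k w from
            sum_congr rfl fun y _ => by rw [sum_mul], sum_comm]
          exact sum_congr rfl fun z _ => by rw [mul_sum]; exact sum_congr rfl fun y _ => by ring
      _ = ∑ z, Cp n x z * ∑ w, U z w * v (k + 1) w := sum_congr rfl fun z _ => by rw [hCU z]
      _ = ∑ w, U x w * v (n + (k + 1)) w := ih (k + 1) x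
      _ = ∑ w, U x w * v (n + 1 + k) w := by rw [show n + (k + 1) = n + 1 + k by ring]

/-- **The shift identity:** `⟨v_i, Uv_{k+1}⟩_π = ⟨v_{i+1}, Uv_k⟩_π`. [ours] -/
theorem cycle_moment_shift (hπ : ∀ x, 0 < π x) (hA0 : ∀ x y, 0 ≤ A x y) (hA1 : ∀ x, ∑ y, A x y = 1) (hrev : ∀ x y, π x * A x y = π y * A y x)
    (hσ0 : 0 ≤ σ) (hσ1 : σ < 1) (hU : ∀ x y, U x y = (1 - σ) * (if x = y then 1 else 0) + σ * ∑ z, A x z * U z y)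
    (hBrev : ∀ x y, π x * B x y = π y * B y x) (hvS : ∀ k x, v (k + 1) x = ∑ y, B x y * ∑ w, U y w * v k w) (i k : ℕ) :
    ∑ x, π x * v i x * ∑ y, U x y * v (k + 1) y = ∑ x, π x * v (i + 1) x * ∑ y, U x y * v k y := by
  -- `⟨v_i, U v_{k+1}⟩ = ⟨v_{k+1}, U v_i⟩ = Σ_x π_x (Σ_z B_{xz} a_z)(Uv_i)_x = Σ_z π_z a_z Σ_x B_{zx}(Uv_i)_x = ⟨v_{i+1}, U v_k⟩`, `a = Uv_k`
  rw [resolventKernel_form_symm hπ hA0 hA1 hrev hσ0 hσ1 hU (v (k + 1)) (v i)]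
  calc ∑ x, π x * v (k + 1) x * ∑ y, U x y * v i y
      = ∑ x, π x * (∑ z, B x z * ∑ w, U z w * v k w) * ∑ y, U x y * v i y := sum_congr rfl fun x _ => by rw [hvS k x]
    _ = ∑ x, ∑ z, π x * B x z * ((∑ w, U z w * v k w) * ∑ y, U x y * v i y) :=
        sum_congr rfl fun x _ => by rw [mul_sum univ _ (π x), sum_mul]; exact sum_congr rfl fun z _ => by ring
    _ = ∑ x, ∑ z, π z * B z x * ((∑ w, U z w * v k w) * ∑ y, U x y * v i y) := sum_congr rfl fun x _ => sum_congr rfl fun z _ => by rw [hBrev x z]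
    _ = ∑ z, ∑ x, π z * B z x * ((∑ w, U z w * v k w) * ∑ y, U x y * v i y) := sum_comm
    _ = ∑ z, π z * (∑ x, B z x * ∑ y, U x y * v i y) * ∑ w, U z w * v k w :=
        sum_congr rfl fun z _ => by rw [mul_sum univ _ (π z), sum_mul]; exact sum_congr rfl fun x _ => by ring
    _ = ∑ z, π z * v (i + 1) z * ∑ w, U z w * v k w := sum_congr rfl fun z _ => by rw [hvS i z]

/-- `M(a)² ≤ M(0)·M(2a)` where `M(n) = ⟨v_0, Uv_n⟩_π` (Cauchy–Schwarz and `a` shifts). [ours] -/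
theorem cycle_moment_sq_le (hπ : ∀ x, 0 < π x) (hA0 : ∀ x y, 0 ≤ A x y) (hA1 : ∀ x, ∑ y, A x y = 1) (hrev : ∀ x y, π x * A x y = π y * A y x)
    (hσ0 : 0 ≤ σ) (hσ1 : σ < 1) (hU : ∀ x y, U x y = (1 - σ) * (if x = y then 1 else 0) + σ * ∑ z, A x z * U z y)
    (hBrev : ∀ x y, π x * B x y = π y * B y x) (hvS : ∀ k x, v (k + 1) x = ∑ y, B x y * ∑ w, U y w * v k w) (a : ℕ) :
    (∑ x, π x * v 0 x * ∑ y, U x y * v a y) ^ 2 ≤ (∑ x, π x * v 0 x * ∑ y, U x y * v 0 y) * (∑ x, π x * v 0 x * ∑ y, U x y * v (2 * a) y) := by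
  -- `a` shifts: `⟨v_0, U v_{2a}⟩ = ⟨v_a, U v_a⟩`
  have hshift : ∀ i k, ∑ x, π x * v i x * ∑ y, U x y * v (k + 1) y = ∑ x, π x * v (i + 1) x * ∑ y, U x y * v k y :=
    cycle_moment_shift hπ hA0 hA1 hrev hσ0 hσ1 hU hBrev hvS
  have hiter : ∀ j i k, ∑ x, π x * v i x * ∑ y, U x y * v (k + j) y = ∑ x, π x * v (i + j) x * ∑ y, U x y * v k y := by
    intro j
    induction j with
    | zero => intro i k; rfl
    | succ j ih => intro i k; rw [show k + (j + 1) = (k + j) + 1 by ring, hshift, show i + (j + 1) = (i + 1) + j by ring, ← ih (i + 1) k]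
  have e : ∑ x, π x * v 0 x * ∑ y, U x y * v (2 * a) y = ∑ x, π x * v a x * ∑ y, U x y * v a y := by
    rw [show 2 * a = a + a by ring, hiter a 0 a, Nat.zero_add]
  rw [e]
  have hcs := resolventKernel_cauchySchwarz hπ hA0 hA1 hrev hσ0 hσ1 hU (v a) (v 0)
  nlinarith [hcs]

/-- `M(1)^{2^k} ≤ M(0)^{2^k − 1}·M(2^k)` (iterate the previous inequality; `M(1) = ‖BUg‖² ≥ 0`). [ours] -/
theorem cycle_moment_pow_le (hπ : ∀ x, 0 < π x) (hA0 : ∀ x y, 0 ≤ A x y) (hA1 : ∀ x, ∑ y, A x y = 1) (hrev : ∀ x y, π x * A x y = π y * A y x)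
    (hσ0 : 0 ≤ σ) (hσ1 : σ < 1) (hU : ∀ x y, U x y = (1 - σ) * (if x = y then 1 else 0) + σ * ∑ z, A x z * U z y)
    (hBrev : ∀ x y, π x * B x y = π y * B y x) (hBB : ∀ x y, ∑ z, B x z * B z y = B x y) (hvS : ∀ k x, v (k + 1) x = ∑ y, B x y * ∑ w, U y w * v k w) (k : ℕ) :
    (∑ x, π x * v 0 x * ∑ y, U x y * v 1 y) ^ (2 ^ k) ≤ (∑ x, π x * v 0 x * ∑ y, U x y * v 0 y) ^ (2 ^ k - 1) * (∑ x, π x * v 0 x * ∑ y, U x y * v (2 ^ k) y) := by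
  set M : ℕ → ℝ := fun n => ∑ x, π x * v 0 x * ∑ y, U x y * v n y with hM
  have hsq : ∀ a, M a ^ 2 ≤ M 0 * M (2 * a) := fun a => cycle_moment_sq_le hπ hA0 hA1 hrev hσ0 hσ1 hU hBrev hvS a
  have hM0 : 0 ≤ M 0 := (sum_nonneg fun x _ => mul_nonneg (hπ x).le (sq_nonneg _)).trans (resolventKernel_form_ge_normSq hπ hA0 hA1 hrev hσ0 hσ1 hU (v 0))
  change M 1 ^ (2 ^ k) ≤ M 0 ^ (2 ^ k - 1) * M (2 ^ k)
  induction k with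
  | zero => simp
  | succ k ih =>
    have hpos : 0 ≤ M 1 ^ (2 ^ k) := by
      rcases Nat.even_or_odd (2 ^ k) with he | ho
      · exact he.pow_nonneg _
      · -- `2^k` odd only for `k = 0`; then `M 1 = ‖BUv_0‖² ≥ 0`
        have h1 : 0 ≤ M 1 := by
          have e : M 1 = ∑ x, π x * (∑ y, B x y * ∑ w, U y w * v 0 w) ^ 2 := by
            simp only [hM]
            have hshift := cycle_moment_shift hπ hA0 hA1 hrev hσ0 hσ1 hU hBrev hvS 0 0
            rw [Nat.zero_add] at hshift
            rw [hshift, ← idem_form_eq_normSq hBrev hBB (fun y => ∑ w, U y w * v 0 w)]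
            have hv1 : ∀ x, v 1 x = ∑ y, B x y * ∑ w, U y w * v 0 w := fun x => hvS 0 x
            exact sum_congr rfl fun x _ => by rw [hv1 x]; ring
          rw [e]; exact sum_nonneg fun x _ => mul_nonneg (hπ x).le (sq_nonneg _)
        exact pow_nonneg h1 _
    calc M 1 ^ (2 ^ (k + 1)) = (M 1 ^ (2 ^ k)) ^ 2 := by rw [pow_succ, pow_mul]
      _ ≤ (M 0 ^ (2 ^ k - 1) * M (2 ^ k)) ^ 2 := pow_le_pow_left₀ hpos ih 2
      _ = M 0 ^ (2 * (2 ^ k - 1)) * M (2 ^ k) ^ 2 := by ring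
      _ ≤ M 0 ^ (2 * (2 ^ k - 1)) * (M 0 * M (2 * 2 ^ k)) := mul_le_mul_of_nonneg_left (hsq _) (pow_nonneg hM0 _)
      _ = M 0 ^ (2 ^ (k + 1) - 1) * M (2 ^ (k + 1)) := by
          have h1 : 1 ≤ 2 ^ k := Nat.one_le_two_pow
          rw [show 2 * 2 ^ k = 2 ^ (k + 1) by ring, show 2 ^ (k + 1) - 1 = 2 * (2 ^ k - 1) + 1 by omega, pow_succ]
          ring

variable {πC : X → ℝ} {C₀ θ : ℝ}

/-- **Decay of the moments:** for mean-zero `g = v_0`, `M(n) = ⟨g, C^n(Ug)⟩_π ≤ ‖g‖_{1,π}·‖Ug‖_∞·2C₀θⁿ`. [ours] -/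
theorem cycle_moment_decay (hπ : ∀ x, 0 < π x) (hC : ∀ x y, C x y = ∑ z, U x z * B z y) (hCp0 : ∀ x y, Cp 0 x y = if x = y then 1 else 0)
    (hCpS : ∀ n x y, Cp (n + 1) x y = ∑ z, Cp n x z * C z y) (hvS : ∀ k x, v (k + 1) x = ∑ y, B x y * ∑ w, U y w * v k w)
    (hg0 : ∑ x, π x * v 0 x = 0) (hdec : ∀ n x, ∑ y, |Cp n x y - πC y| ≤ 2 * C₀ * θ ^ n) {R : ℝ} (hR0 : 0 ≤ R) (hR : ∀ y, |∑ w, U y w * v 0 w| ≤ R) (n : ℕ) :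
    ∑ x, π x * v 0 x * ∑ y, U x y * v n y ≤ (∑ x, π x * |v 0 x|) * R * (2 * C₀ * θ ^ n) := by
  have hpow := cycle_pow_apply hC hCp0 hCpS hvS n 0
  simp only [Nat.add_zero] at hpow
  -- `⟨g, U v_n⟩ = Σ_x π x g x Σ_y (C^n(x,y) − π_C(y)) (Ug)(y)`
  have e : ∑ x, π x * v 0 x * ∑ y, U x y * v n y = ∑ x, π x * v 0 x * ∑ y, (Cp n x y - πC y) * ∑ w, U y w * v 0 w := by
    have hconst : ∑ x, π x * v 0 x * ∑ y, πC y * ∑ w, U y w * v 0 w = 0 := by rw [← sum_mul, hg0, zero_mul]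
    rw [show (∑ x, π x * v 0 x * ∑ y, (Cp n x y - πC y) * ∑ w, U y w * v 0 w)
        = ∑ x, π x * v 0 x * ∑ y, Cp n x y * ∑ w, U y w * v 0 w - ∑ x, π x * v 0 x * ∑ y, πC y * ∑ w, U y w * v 0 w from by
        rw [← sum_sub_distrib]; refine sum_congr rfl fun x _ => ?_; rw [← mul_sub, ← sum_sub_distrib]
        exact congrArg _ (sum_congr rfl fun y _ => by ring), hconst, sub_zero]
    exact sum_congr rfl fun x _ => by rw [hpow x]
  rw [e]
  calc ∑ x, π x * v 0 x * ∑ y, (Cp n x y - πC y) * ∑ w, U y w * v 0 w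
      ≤ ∑ x, π x * |v 0 x| * (R * (2 * C₀ * θ ^ n)) := by
        refine sum_le_sum fun x _ => ?_
        have hb : |∑ y, (Cp n x y - πC y) * ∑ w, U y w * v 0 w| ≤ R * (2 * C₀ * θ ^ n) := by
          calc |∑ y, (Cp n x y - πC y) * ∑ w, U y w * v 0 w| ≤ ∑ y, |(Cp n x y - πC y) * ∑ w, U y w * v 0 w| := abs_sum_le_sum_abs _ _
            _ = ∑ y, |Cp n x y - πC y| * |∑ w, U y w * v 0 w| := sum_congr rfl fun y _ => abs_mul _ _
            _ ≤ ∑ y, |Cp n x y - πC y| * R := sum_le_sum fun y _ => mul_le_mul_of_nonneg_left (hR y) (abs_nonneg _)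
            _ = (∑ y, |Cp n x y - πC y|) * R := by rw [sum_mul]
            _ ≤ (2 * C₀ * θ ^ n) * R := mul_le_mul_of_nonneg_right (hdec n x) hR0
            _ = R * (2 * C₀ * θ ^ n) := mul_comm _ _
        have : π x * v 0 x * ∑ y, (Cp n x y - πC y) * ∑ w, U y w * v 0 w ≤ |π x * v 0 x| * (R * (2 * C₀ * θ ^ n)) := by
          calc π x * v 0 x * ∑ y, (Cp n x y - πC y) * ∑ w, U y w * v 0 w ≤ |π x * v 0 x * ∑ y, (Cp n x y - πC y) * ∑ w, U y w * v 0 w| := le_abs_self _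
            _ = |π x * v 0 x| * |∑ y, (Cp n x y - πC y) * ∑ w, U y w * v 0 w| := abs_mul _ _
            _ ≤ |π x * v 0 x| * (R * (2 * C₀ * θ ^ n)) := mul_le_mul_of_nonneg_left hb (abs_nonneg _)
        rwa [abs_mul, abs_of_pos (hπ x)] at this
    _ = (∑ x, π x * |v 0 x|) * R * (2 * C₀ * θ ^ n) := by rw [← sum_mul]; ring

/-- **THE FORM BOUND:** under the hypotheses of files X1–X2 (reversible `A`, resolvent `U`, reversible idempotent `B`, `C = UB` with powers `C^n`, decay `Σ_y|C^n(x,y) − π_C(y)| ≤ 2C₀θⁿ`,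
`0 < θ`), every `g` with `Σ_x π(x)g(x) = 0` satisfies **`‖BUg‖²_π ≤ θ·⟨g,Ug⟩_π`**. [ours] -/
theorem cycleStep_form_bound [Nonempty X] (hπ : ∀ x, 0 < π x) (hA0 : ∀ x y, 0 ≤ A x y) (hA1 : ∀ x, ∑ y, A x y = 1) (hrev : ∀ x y, π x * A x y = π y * A y x)
    (hσ0 : 0 ≤ σ) (hσ1 : σ < 1) (hU : ∀ x y, U x y = (1 - σ) * (if x = y then 1 else 0) + σ * ∑ z, A x z * U z y)
    (hBrev : ∀ x y, π x * B x y = π y * B y x) (hBB : ∀ x y, ∑ z, B x z * B z y = B x y)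
    (hC : ∀ x y, C x y = ∑ z, U x z * B z y) (hCp0 : ∀ x y, Cp 0 x y = if x = y then 1 else 0) (hCpS : ∀ n x y, Cp (n + 1) x y = ∑ z, Cp n x z * C z y)
    (hθ0 : 0 < θ) (hdec : ∀ n x, ∑ y, |Cp n x y - πC y| ≤ 2 * C₀ * θ ^ n)
    (g : X → ℝ) (hg0 : ∑ x, π x * g x = 0) :
    ∑ x, π x * (∑ y, B x y * ∑ w, U y w * g w) ^ 2 ≤ θ * ∑ x, π x * g x * ∑ y, U x y * g y := by
  classical
  -- the orbit `v_k = (BU)^k g`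
  let v : ℕ → X → ℝ := fun k => Nat.rec g (fun _ vk => fun x => ∑ y, B x y * ∑ w, U y w * vk w) k
  have hv0 : v 0 = g := rfl
  have hvS : ∀ k x, v (k + 1) x = ∑ y, B x y * ∑ w, U y w * v k w := fun k x => rfl
  set M : ℕ → ℝ := fun n => ∑ x, π x * v 0 x * ∑ y, U x y * v n y with hM
  -- `M 1 = ‖BUg‖²`, `M 0 = ⟨g,Ug⟩`
  have hM1 : M 1 = ∑ x, π x * (∑ y, B x y * ∑ w, U y w * g w) ^ 2 := by
    simp only [hM]
    have hshift := cycle_moment_shift hπ hA0 hA1 hrev hσ0 hσ1 hU hBrev hvS 0 0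
    rw [Nat.zero_add] at hshift
    rw [hshift, ← idem_form_eq_normSq hBrev hBB (fun y => ∑ w, U y w * g w)]
    have hv1 : ∀ x, v 1 x = ∑ y, B x y * ∑ w, U y w * g w := fun x => hvS 0 x
    exact sum_congr rfl fun x _ => by rw [hv1 x, hv0]; ring
  have hM0 : M 0 = ∑ x, π x * g x * ∑ y, U x y * g y := by simp only [hM, hv0]
  rw [← hM1, ← hM0]
  have hM0nn : 0 ≤ M 0 := by
    rw [hM0]; exact (sum_nonneg fun x _ => mul_nonneg (hπ x).le (sq_nonneg _)).trans (resolventKernel_form_ge_normSq hπ hA0 hA1 hrev hσ0 hσ1 hU g)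
  have hM1nn : 0 ≤ M 1 := by rw [hM1]; exact sum_nonneg fun x _ => mul_nonneg (hπ x).le (sq_nonneg _)
  have hpow : ∀ k, M 1 ^ (2 ^ k) ≤ M 0 ^ (2 ^ k - 1) * M (2 ^ k) := fun k => cycle_moment_pow_le hπ hA0 hA1 hrev hσ0 hσ1 hU hBrev hBB hvS k
  -- decay: `M n ≤ D θ^n`
  obtain ⟨R, hR⟩ : ∃ R, ∀ y, |∑ w, U y w * v 0 w| ≤ R :=
    ⟨(univ.image fun y => |∑ w, U y w * v 0 w|).max' (by simp), fun y =>
      Finset.le_max' (univ.image fun y => |∑ w, U y w * v 0 w|) (|∑ w, U y w * v 0 w|) (Finset.mem_image.mpr ⟨y, mem_univ y, rfl⟩)⟩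
  have hR0 : 0 ≤ R := (abs_nonneg _).trans (hR (Classical.arbitrary X))
  have hg0' : ∑ x, π x * v 0 x = 0 := by rw [hv0]; exact hg0
  have hdecM : ∀ n, M n ≤ (∑ x, π x * |v 0 x|) * R * (2 * C₀ * θ ^ n) := fun n => cycle_moment_decay hπ hC hCp0 hCpS hvS hg0' hdec hR0 hR n
  set D : ℝ := (∑ x, π x * |v 0 x|) * R * (2 * C₀) with hD
  have hdecM' : ∀ n, M n ≤ D * θ ^ n := fun n => by have := hdecM n; rw [hD]; linarith [this]
  -- conclude by contradiction: if `M 1 > θ M 0` then `(M 1/(θ M 0))^{2^k}` is unbounded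
  refine le_of_not_gt fun hlt => ?_
  have hM0pos : 0 < M 0 := by
    rcases eq_or_lt_of_le hM0nn with h | h
    · -- `M 0 = 0 ⇒ M 1 = 0` by Cauchy–Schwarz (`M 1² ≤ M 0 M 2`)
      have := cycle_moment_sq_le hπ hA0 hA1 hrev hσ0 hσ1 hU hBrev hvS 1
      have h1 : M 1 ^ 2 ≤ M 0 * M 2 := this
      rw [← h, zero_mul] at h1
      have : M 1 = 0 := by nlinarith [sq_nonneg (M 1)]
      rw [this, ← h, mul_zero] at hlt
      exact absurd hlt (lt_irrefl 0)
    · exact h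
  set r : ℝ := M 1 / (θ * M 0) with hr
  have hr1 : 1 < r := by rw [hr, lt_div_iff₀ (mul_pos hθ0 hM0pos)]; linarith
  -- `r^{2^k} ≤ D/ M 0` for all `k`
  have hbound : ∀ k, r ^ (2 ^ k) ≤ D / M 0 := by
    intro k
    have h1 := hpow k
    have h2 := hdecM' (2 ^ k)
    have hθM : 0 < (θ * M 0) ^ (2 ^ k) := pow_pos (mul_pos hθ0 hM0pos) _
    rw [hr, div_pow, div_le_div_iff₀ hθM hM0pos]
    calc M 1 ^ 2 ^ k * M 0 ≤ M 0 ^ (2 ^ k - 1) * M (2 ^ k) * M 0 := mul_le_mul_of_nonneg_right h1 hM0pos.le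
      _ ≤ M 0 ^ (2 ^ k - 1) * (D * θ ^ (2 ^ k)) * M 0 := mul_le_mul_of_nonneg_right (mul_le_mul_of_nonneg_left h2 (pow_nonneg hM0nn _)) hM0pos.le
      _ = D * (θ * M 0) ^ 2 ^ k := by
          have : M 0 ^ (2 ^ k - 1) * M 0 = M 0 ^ (2 ^ k) := by rw [← pow_succ, Nat.sub_add_cancel Nat.one_le_two_pow]
          rw [mul_pow]; calc M 0 ^ (2 ^ k - 1) * (D * θ ^ 2 ^ k) * M 0 = D * θ ^ 2 ^ k * (M 0 ^ (2 ^ k - 1) * M 0) := by ring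
            _ = D * θ ^ 2 ^ k * M 0 ^ 2 ^ k := by rw [this]
            _ = D * (θ ^ 2 ^ k * M 0 ^ 2 ^ k) := by ring
  -- but `r^{2^k} ≥ r^k → ∞`
  have htend := tendsto_pow_atTop_atTop_of_one_lt hr1
  obtain ⟨k, hk⟩ := (Filter.tendsto_atTop.mp htend (D / M 0 + 1)).exists
  have hk2 : r ^ k ≤ r ^ (2 ^ k) := pow_le_pow_right₀ hr1.le (Nat.lt_two_pow_self).le
  linarith [hbound k]

end CycleStep

end Summit.Ventures.LatticeQCDFlow.Scaling
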